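import Literature.NumberTheory.Automorphic.UnipotentAdelicHaar
import Literature.NumberTheory.Automorphic.GLnIwasawaIntegration
import Literature.NumberTheory.Automorphic.HaarIntegralClosedCompactProofs
import Literature.NumberTheory.Automorphic.IwasawaDecompositionAdelic
import Literature.NumberTheory.Automorphic.GLnMaximalCompactCompact
import Literature.NumberTheory.Automorphic.AdelicVectorHeightCompact
import Literature.NumberTheory.Automorphic.AdeleRingTopology
import HarnessLib

/-!
# Volume decay of translated Siegel boxes in `GL_n(𝔸_K)`:
# `ν(a⁻¹ C a · D · K) ≤ C · ∏_{i<j} (b_j/b_i)^{[K:ℚ]}`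

Topic `NumberTheory/Automorphic`; namespace `Literature.NumberTheory.Automorphic`. Second layer of the
proof of Borel–Harish-Chandra finiteness for `GL_n` (`AdelicGroupData.exists_isAutomorphicMeasure_gl`,
Borel (1963), Thm. 5.8). The finiteness of the Haar volume of a Siegel set `Ω A_{T₀}(t) K` comes from the
decay of the volume of its slices along the cone: for `a = diag(b)` positive real diagonal and fixed
compact `C ⊆ B(𝔸_K)`, compact diagonal `D` and the standard maximal compact `K = K_∞ GL_n(𝒪̂_K)`,
`ν(a⁻¹ C a · D · K)` is at most a constant times `∏_{i<j} (b_j/b_i)^{[K:ℚ]}` (the value at `a⁻¹` of the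
modular function of the Borel subgroup). Everything here is proved:

* `fst_apply_eq_zero_of_mem_K_of_blockTriangular` — **the archimedean part of an upper triangular
  element of `K` is diagonal** (`k_∞ ∈ U(n, ℝ^{r₁} × ℂ^{r₂})` is unitary and upper triangular, so
  `k_∞⁻¹ = k_∞^*` is upper and lower triangular); this is why the dilations `a ∈ A_{T₀}` (archimedean)
  do not distort the `K ∩ B(𝔸_K)`-ambiguity of the Iwasawa coordinates.
* `leviProjB_of_eq`, `unipMatrix_of_eq`, `unipMatrix_fst_of_eq`, `unipMatrix_snd_of_eq` — the Levi part
  and the entries of the unipotent part of `m u = a⁻¹ c a · d · k`: the `(i, j)` entry of `u` has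
  archimedean component `(b_j/b_i) · y_∞` and finite component `y_f` with `y` in a fixed compact set.
* `exists_measure_coneConj_mul_le` — **the volume decay estimate**, from the Haar measure of
  `GL_n(𝔸_K)` in Iwasawa coordinates `G = B K` (`HaarHK.eq_smul_map_prod` of
  `HaarIntegralClosedCompactProofs`, with `iwasawaDecomposition_gl_adelic_holds` and
  `isCompact_standardMaximalCompactGL`), of `B = M ⋉ N` in Levi coordinates
  (`IsTopSemidirect.isHaarMeasure_map` of `SemidirectHaar`, `isTopSemidirect_parabolicAdelic`, with the
  coordinate Haar measure of `N(𝔸_K)` of `UnipotentAdelicHaar`), and `vol((t,1) · E) = t^{[K:ℚ]} vol(E)`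
  on `𝔸_K` (`AdeleRing.addHaar_posRealIdele_smul`).

This is the computation behind "Siegel sets have finite volume" (Borel, *Introduction aux groupes
arithmétiques* (1969), §12; Godement, Sém. Bourbaki 257, §8; Borel (1963), proof of Thm. 5.6 via
[4, 12.3]); no printed source isolates it in this form, so the statements are tagged folklore.

## References

* A. Borel, *Some finiteness properties of adele groups over number fields*, Publ. Math. IHÉS 16
  (1963), §5 [Borel1963].
* R. Godement, *Domaines fondamentaux des groupes arithmétiques*, Sém. Bourbaki 257 (1962/63), §8.
* J. R. Getz, H. Hahn, *An Introduction to Automorphic Representations* (2024), §2.7, §3.2 [GetzHahn2024].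
-/

noncomputable section

open MeasureTheory Measure Set Function NumberField IsDedekindDomain
open scoped ENNReal NNReal Pointwise

namespace Literature.NumberTheory.Automorphic

/-! ### `K ∩ B(𝔸_K)`: the archimedean components of `K`-elements of the Borel are diagonal -/

section CompactBorel

variable {n : ℕ} {K : Type} [Field K] [NumberField K]

/-- Entries of the archimedean part `g_∞ ∈ GL_n(ℝ^{r₁} × ℂ^{r₂})` of `g ∈ GL_n(𝔸_K)`:
`(g_∞)_{ij}` is the image of the archimedean component of `g_{ij}`. [folklore] -/
theorem coe_toMixed_apply (g : GL (Fin n) (AdeleRing (𝓞 K) K)) (i j : Fin n) :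
    ((GLn.toMixed n K g : GL (Fin n) (mixedEmbedding.mixedSpace K)) :
        Matrix (Fin n) (Fin n) (mixedEmbedding.mixedSpace K)) i j =
      InfiniteAdeleRing.ringEquiv_mixedSpace K (((g : Matrix (Fin n) (Fin n) (AdeleRing (𝓞 K) K)) i j).1) :=
  rfl

/-- **An element of `K` which is upper triangular has diagonal archimedean part**: for
`k ∈ K ∩ B(𝔸_K)` and `i ≠ j` the archimedean component of `k_{ij}` vanishes. Indeed `k_∞` is
unitary (`K_∞ = U(n, ℝ^{r₁} × ℂ^{r₂})`) and upper triangular, so `k_∞⁻¹ = k_∞^*` is both upper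
(inverse of an upper triangular matrix) and lower triangular. [folklore] -/
theorem fst_apply_eq_zero_of_mem_K_of_blockTriangular {k : GL (Fin n) (AdeleRing (𝓞 K) K)}
    (hk : k ∈ standardMaximalCompactGL n K)
    (hkB : (k : Matrix (Fin n) (Fin n) (AdeleRing (𝓞 K) K)).BlockTriangular id) {i j : Fin n}
    (hij : i ≠ j) : ((k : Matrix (Fin n) (Fin n) (AdeleRing (𝓞 K) K)) i j).1 = 0 := by
  classical
  set gm : Matrix (Fin n) (Fin n) (mixedEmbedding.mixedSpace K) :=
    ((GLn.toMixed n K k : GL (Fin n) (mixedEmbedding.mixedSpace K)) :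
      Matrix (Fin n) (Fin n) (mixedEmbedding.mixedSpace K)) with hgm
  -- `gm` is upper triangular
  have hgmB : gm.BlockTriangular id := by
    intro a b hab
    rw [hgm, coe_toMixed_apply, hkB hab]
    exact map_zero _
  -- `gm` is unitary: `star gm * gm = 1`
  have hunit : star gm * gm = 1 := by
    have h := toMixed_mem_Kinf_of_mem_standardMaximalCompactGL hk
    rw [Kinf_eq_unitarySubgroupGL, mem_unitarySubgroupGL_iff] at h
    exact h
  -- hence `gm⁻¹ = star gm` is upper triangular, i.e. `gm` is also lower triangular
  have hinv : gm⁻¹ = star gm := Matrix.inv_eq_left_inv hunit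
  have hstarB : (star gm).BlockTriangular id := by
    rw [← hinv]
    exact Matrix.blockTriangular_inv_of_blockTriangular hgmB
  have hzero : gm i j = 0 := by
    rcases lt_or_gt_of_ne hij with h | h
    · -- `i < j`: use lower triangularity from `star gm`
      have := hstarB (show id i < id j from h)
      -- `(star gm) j i = star (gm i j) = 0`
      rw [Matrix.star_apply] at this
      exact star_eq_zero.1 this
    · exact hgmB h
  rw [hgm, coe_toMixed_apply] at hzero
  exact (map_eq_zero_iff _ (InfiniteAdeleRing.ringEquiv_mixedSpace K).injective).1 hzero

end CompactBorel


/-! ### The Levi decomposition of the adelic Borel: diagonal parts and entries -/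

section LeviEntries

variable {n : ℕ} {K : Type} [Field K] [NumberField K]

/-- Components of a product of adeles (the adele ring is `K_∞ × 𝔸_K^∞`; definitional, recorded because
`rw [Prod.fst_mul]` does not see through the ring structure of `AdeleRing`; a copy of `fst_mul_adele` of
`SatakeParameterTrivialBound`, not imported here). [folklore] -/
theorem AdeleRing.mul_fst (x y : AdeleRing (𝓞 K) K) : (x * y).1 = x.1 * y.1 := rfl

/-- Components of a product of adeles (finite part). [folklore] -/
theorem AdeleRing.mul_snd (x y : AdeleRing (𝓞 K) K) : (x * y).2 = x.2 * y.2 := rfl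

/-- Archimedean component of a finite sum of adeles. [folklore] -/
theorem AdeleRing.sum_fst {ι : Type*} (s : Finset ι) (f : ι → AdeleRing (𝓞 K) K) :
    (∑ i ∈ s, f i).1 = ∑ i ∈ s, (f i).1 :=
  map_sum (RingHom.fst (InfiniteAdeleRing K) (FiniteAdeleRing (𝓞 K) K)) f s

/-- Finite component of a finite sum of adeles. [folklore] -/
theorem AdeleRing.sum_snd {ι : Type*} (s : Finset ι) (f : ι → AdeleRing (𝓞 K) K) :
    (∑ i ∈ s, f i).2 = ∑ i ∈ s, (f i).2 :=
  map_sum (RingHom.snd (InfiniteAdeleRing K) (FiniteAdeleRing (𝓞 K) K)) f s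

/-- Archimedean component of `0`. [folklore] -/
theorem AdeleRing.zero_fst : (0 : AdeleRing (𝓞 K) K).1 = 0 := rfl

/-- The matrix of an element of the adelic Borel subgroup. [folklore] -/
abbrev borelMatrix (p : ↥(borelAdelic n K)) : Matrix (Fin n) (Fin n) (AdeleRing (𝓞 K) K) :=
  adelicMatrix (p : (AdelicGroupData.gl n K).Adelic)

/-- `borelMatrix` is multiplicative. [folklore] -/
theorem borelMatrix_mul (p q : ↥(borelAdelic n K)) :
    borelMatrix (p * q) = borelMatrix p * borelMatrix q := rfl

/-- `borelMatrix` is continuous. [folklore] -/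
theorem continuous_borelMatrix : Continuous (borelMatrix (n := n) (K := K)) :=
  continuous_adelicMatrix.comp continuous_subtype_val

/-- Elements of the Borel are upper triangular. [folklore] -/
theorem borelMatrix_blockTriangular (p : ↥(borelAdelic n K)) : (borelMatrix p).BlockTriangular id :=
  p.2

/-- The Levi projection `ℓ : B(𝔸_K) →* ∏_i GL_1(𝔸_K)` of the Borel (`leviProjection` for
`c = id`). [folklore] -/
abbrev leviProjB : ↥(borelAdelic n K) →* (Π a : Fin n, GL {i : Fin n // id i = a} (AdeleRing (𝓞 K) K)) :=
  leviProjection (AdeleRing (𝓞 K) K) (id : Fin n → Fin n)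

/-- **The Levi projection of the Borel only sees the diagonal entries.** [folklore] -/
theorem leviProjB_eq_of_diag_eq {p q : ↥(borelAdelic n K)} (h : ∀ i, borelMatrix p i i = borelMatrix q i i) :
    leviProjB p = leviProjB q := by
  funext a
  refine Units.ext (Matrix.ext fun i j => ?_)
  change ((leviProjection (AdeleRing (𝓞 K) K) id p a : GL {i : Fin n // id i = a} (AdeleRing (𝓞 K) K)) :
      Matrix _ _ (AdeleRing (𝓞 K) K)) i j =
    ((leviProjection (AdeleRing (𝓞 K) K) id q a : GL {i : Fin n // id i = a} (AdeleRing (𝓞 K) K)) :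
      Matrix _ _ (AdeleRing (𝓞 K) K)) i j
  rw [leviProjection_apply_coe, leviProjection_apply_coe]
  obtain ⟨i, hi⟩ := i
  obtain ⟨j, hj⟩ := j
  have hij : j = i := hj.trans hi.symm
  subst hij
  exact h j

/-- The Levi projection kills the unipotent radical. [folklore] -/
theorem leviProjB_unip (u : ↥(unipotentBorelAdelic n K)) : leviProjB (u : ↥(borelAdelic n K)) = 1 :=
  (MonoidHom.mem_ker).1 u.2

/-- **Elements of the Levi subgroup are diagonal matrices.** [folklore] -/
theorem borelMatrix_levi_apply_ne {m : ↥(borelAdelic n K)} (hm : m ∈ leviBorelAdelic n K) {i j : Fin n}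
    (hij : i ≠ j) : borelMatrix m i j = 0 := by
  have hm' : leviEmbeddingP (AdeleRing (𝓞 K) K) id (leviProjB m) = m := (mem_leviP_iff m).1 hm
  have : borelMatrix m = borelMatrix (leviEmbeddingP (AdeleRing (𝓞 K) K) id (leviProjB m)) := by rw [hm']
  rw [this]
  change ((blockDiagonalGL (AdeleRing (𝓞 K) K) (id : Fin n → Fin n) (leviProjB m) :
    GL (Fin n) (AdeleRing (𝓞 K) K)) : Matrix (Fin n) (Fin n) (AdeleRing (𝓞 K) K)) i j = 0
  rw [blockDiagonalGL_apply_coe]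
  exact Matrix.blockDiagonal'_apply_ne _ _ _ hij

/-- A matrix with vanishing off-diagonal entries is the diagonal matrix of its diagonal. [folklore] -/
theorem matrix_eq_diagonal_of_apply_ne {R : Type*} [Zero R] {M : Matrix (Fin n) (Fin n) R}
    (h : ∀ i j, i ≠ j → M i j = 0) : M = Matrix.diagonal fun i => M i i := by
  ext i j
  by_cases hij : i = j
  · subst hij; rw [Matrix.diagonal_apply_eq]
  · rw [Matrix.diagonal_apply_ne _ hij, h i j hij]

/-- The positive real diagonal cone element `a = diag(b)` as an element of the Borel. [folklore] -/
def coneBorel (b : Fin n → ℝ≥0ˣ) : ↥(borelAdelic n K) :=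
  ⟨posRealDiagonal n K b, posRealDiagonal_mem_standardParabolicGL b⟩

/-- The cone element `a = diag(b)` as an element of `GL_n(𝔸_K) = (AdelicGroupData.gl n K).Adelic`.
[folklore] -/
def coneAdelic (b : Fin n → ℝ≥0ˣ) : (AdelicGroupData.gl n K).Adelic :=
  ((coneBorel b : ↥(borelAdelic n K)) : (AdelicGroupData.gl n K).Adelic)

/-- `coneAdelic b` is `posRealDiagonal n K b` (definitional). [folklore] -/
theorem coneAdelic_eq (b : Fin n → ℝ≥0ˣ) :
    (coneAdelic b : (AdelicGroupData.gl n K).Adelic) = (posRealDiagonal n K b : GL (Fin n) (AdeleRing (𝓞 K) K)) :=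
  rfl

/-- Entries of `a⁻¹ c a` for `a = diag(b)`: `(a⁻¹ c a)_{ij} = (b_j/b_i, 1) · c_{ij}`
(`coe_posRealDiagonal_inv_mul_mul_posRealDiagonal_apply`). [folklore] -/
theorem borelMatrix_coneConj_apply (b : Fin n → ℝ≥0ˣ) (c : ↥(borelAdelic n K)) (i j : Fin n) :
    borelMatrix ((coneBorel b)⁻¹ * c * coneBorel b) i j =
      realAdele K (((b j : ℝ≥0) : ℝ) / ((b i : ℝ≥0) : ℝ)) * borelMatrix c i j :=
  coe_posRealDiagonal_inv_mul_mul_posRealDiagonal_apply b _ i j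

/-- Conjugating by the cone does not change the Levi projection. [folklore] -/
theorem leviProjB_coneConj (b : Fin n → ℝ≥0ˣ) (c : ↥(borelAdelic n K)) :
    leviProjB ((coneBorel b)⁻¹ * c * coneBorel b) = leviProjB c := by
  refine leviProjB_eq_of_diag_eq fun i => ?_
  rw [borelMatrix_coneConj_apply, div_self (NNReal.coe_ne_zero.2 (b i).ne_zero), realAdele_one, one_mul]

/-- **The Levi part of the fibre equation.** If `m u = a⁻¹ c a · d · k` in the Borel with `m`
in the Levi subgroup and `u` unipotent, then `ℓ(m) = ℓ(c) ℓ(d) ℓ(k)`. [folklore] -/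
theorem leviProjB_of_eq {b : Fin n → ℝ≥0ˣ} {m : ↥(leviBorelAdelic n K)} {u : ↥(unipotentBorelAdelic n K)}
    {c d k : ↥(borelAdelic n K)}
    (h : (m : ↥(borelAdelic n K)) * (u : ↥(borelAdelic n K)) = (coneBorel b)⁻¹ * c * coneBorel b * d * k) :
    leviProjB (m : ↥(borelAdelic n K)) = leviProjB c * leviProjB d * leviProjB k := by
  have h1 := congrArg leviProjB h
  rw [map_mul, leviProjB_unip, mul_one, map_mul, map_mul, leviProjB_coneConj] at h1
  exact h1

/-- **The unipotent part of the fibre equation, entrywise.** If `m u = a⁻¹ c a · d · k` with `m`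
in the Levi, `u` unipotent and `d` diagonal, then
`u_{ij} = (m⁻¹)_{ii} · ∑_l (b_l/b_i, 1) c_{il} · d_{ll} · k_{lj}`. [folklore] -/
theorem unipMatrix_of_eq {b : Fin n → ℝ≥0ˣ} {m : ↥(leviBorelAdelic n K)} {u : ↥(unipotentBorelAdelic n K)}
    {c d k : ↥(borelAdelic n K)} (hd : d ∈ leviBorelAdelic n K)
    (h : (m : ↥(borelAdelic n K)) * (u : ↥(borelAdelic n K)) = (coneBorel b)⁻¹ * c * coneBorel b * d * k)
    (i j : Fin n) :
    unipMatrix u i j = borelMatrix ((m⁻¹ : ↥(leviBorelAdelic n K)) : ↥(borelAdelic n K)) i i *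
      ∑ l, realAdele K (((b l : ℝ≥0) : ℝ) / ((b i : ℝ≥0) : ℝ)) * borelMatrix c i l *
        (borelMatrix d l l * borelMatrix k l j) := by
  have hu : (u : ↥(borelAdelic n K)) =
      ((m⁻¹ : ↥(leviBorelAdelic n K)) : ↥(borelAdelic n K)) * ((coneBorel b)⁻¹ * c * coneBorel b * d * k) := by
    rw [← h, ← mul_assoc, Subgroup.coe_inv, inv_mul_cancel, one_mul]
  have hmdiag := matrix_eq_diagonal_of_apply_ne
    (M := borelMatrix ((m⁻¹ : ↥(leviBorelAdelic n K)) : ↥(borelAdelic n K)))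
    (fun i j hij => borelMatrix_levi_apply_ne (m⁻¹ : ↥(leviBorelAdelic n K)).2 hij)
  have hddiag := matrix_eq_diagonal_of_apply_ne (M := borelMatrix d)
    (fun i j hij => borelMatrix_levi_apply_ne hd hij)
  change borelMatrix (u : ↥(borelAdelic n K)) i j = _
  conv_lhs => rw [hu, borelMatrix_mul, hmdiag, Matrix.diagonal_mul, borelMatrix_mul, Matrix.mul_apply]
  refine congrArg (borelMatrix ((m⁻¹ : ↥(leviBorelAdelic n K)) : ↥(borelAdelic n K)) i i * ·)
    (Finset.sum_congr rfl fun l _ => ?_)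
  rw [borelMatrix_mul, Matrix.mul_apply, Finset.sum_eq_single l]
  · rw [borelMatrix_coneConj_apply, mul_assoc]
  · intro x _ hxl
    rw [borelMatrix_levi_apply_ne hd hxl, mul_zero]
  · intro hl; exact absurd (Finset.mem_univ l) hl

/-- **Archimedean component of the entries of the unipotent part** when `k ∈ K`: only the term
`l = j` survives, because the archimedean components of the off-diagonal entries of `k` vanish
(`fst_apply_eq_zero_of_mem_K_of_blockTriangular`):
`(u_{ij})_∞ = (b_j/b_i) · ((m⁻¹)_{ii} c_{ij} d_{jj} k_{jj})_∞`. [folklore] -/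
theorem unipMatrix_fst_of_eq {b : Fin n → ℝ≥0ˣ} {m : ↥(leviBorelAdelic n K)} {u : ↥(unipotentBorelAdelic n K)}
    {c d k : ↥(borelAdelic n K)} (hd : d ∈ leviBorelAdelic n K)
    (hk : ((k : (AdelicGroupData.gl n K).Adelic) : GL (Fin n) (AdeleRing (𝓞 K) K)) ∈ standardMaximalCompactGL n K)
    (h : (m : ↥(borelAdelic n K)) * (u : ↥(borelAdelic n K)) = (coneBorel b)⁻¹ * c * coneBorel b * d * k)
    (i j : Fin n) :
    (unipMatrix u i j).1 = realToInfiniteAdele K (((b j : ℝ≥0) : ℝ) / ((b i : ℝ≥0) : ℝ)) *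
      (borelMatrix ((m⁻¹ : ↥(leviBorelAdelic n K)) : ↥(borelAdelic n K)) i i *
        borelMatrix c i j * (borelMatrix d j j * borelMatrix k j j)).1 := by
  rw [unipMatrix_of_eq hd h i j, AdeleRing.mul_fst, AdeleRing.sum_fst,
    Finset.sum_eq_single j, AdeleRing.mul_fst, AdeleRing.mul_fst, realAdele_fst]
  · simp only [AdeleRing.mul_fst]; ring
  · intro l _ hlj
    have hk0 : (borelMatrix k l j).1 = 0 :=
      fst_apply_eq_zero_of_mem_K_of_blockTriangular hk (borelMatrix_blockTriangular k) hlj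
    rw [AdeleRing.mul_fst, AdeleRing.mul_fst, AdeleRing.mul_fst, hk0, mul_zero, mul_zero]
  · intro hj; exact absurd (Finset.mem_univ j) hj

/-- **Finite component of the entries of the unipotent part**: no scaling at the finite places,
`(u_{ij})_f = ((m⁻¹)_{ii} ∑_l c_{il} d_{ll} k_{lj})_f`. [folklore] -/
theorem unipMatrix_snd_of_eq {b : Fin n → ℝ≥0ˣ} {m : ↥(leviBorelAdelic n K)} {u : ↥(unipotentBorelAdelic n K)}
    {c d k : ↥(borelAdelic n K)} (hd : d ∈ leviBorelAdelic n K)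
    (h : (m : ↥(borelAdelic n K)) * (u : ↥(borelAdelic n K)) = (coneBorel b)⁻¹ * c * coneBorel b * d * k)
    (i j : Fin n) :
    (unipMatrix u i j).2 = (borelMatrix ((m⁻¹ : ↥(leviBorelAdelic n K)) : ↥(borelAdelic n K)) i i *
      ∑ l, borelMatrix c i l * (borelMatrix d l l * borelMatrix k l j)).2 := by
  rw [unipMatrix_of_eq hd h i j, AdeleRing.mul_snd, AdeleRing.mul_snd, AdeleRing.sum_snd,
    AdeleRing.sum_snd]
  refine congrArg ((borelMatrix ((m⁻¹ : ↥(leviBorelAdelic n K)) : ↥(borelAdelic n K)) i i).2 * ·)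
    (Finset.sum_congr rfl fun l _ => ?_)
  rw [mul_assoc, AdeleRing.mul_snd, realAdele_snd, one_mul]

end LeviEntries


/-! ### The fibre of a translated Siegel box over the Levi: set-theoretic packaging -/

section Fibre

variable {n : ℕ} {K : Type} [Field K] [NumberField K]

/-- A Borel element with vanishing off-diagonal entries lies in the Levi subgroup. [folklore] -/
theorem mem_leviBorelAdelic_of_apply_ne {d : ↥(borelAdelic n K)}
    (hd : ∀ i j, i ≠ j → borelMatrix d i j = 0) : d ∈ leviBorelAdelic n K := by
  refine (mem_leviP_iff d).2 (Subtype.ext (Units.ext (Matrix.ext fun i j => ?_)))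
  change ((blockDiagonalGL (AdeleRing (𝓞 K) K) (id : Fin n → Fin n) (leviProjB d) :
    GL (Fin n) (AdeleRing (𝓞 K) K)) : Matrix (Fin n) (Fin n) (AdeleRing (𝓞 K) K)) i j = borelMatrix d i j
  rw [blockDiagonalGL_apply_coe]
  by_cases hij : i = j
  · subst hij
    rw [Matrix.blockDiagonal'_apply_eq]
    rfl
  · exact (Matrix.blockDiagonal'_apply_ne _ _ _ hij).trans (hd i j hij).symm

/-- The Levi element with given diagonal blocks (`leviEmbeddingP`, valued in the Levi subgroup).
[folklore] -/
def leviOfBlocks (x : Π a : Fin n, GL {i : Fin n // id i = a} (AdeleRing (𝓞 K) K)) :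
    ↥(leviBorelAdelic n K) :=
  ⟨leviEmbeddingP (AdeleRing (𝓞 K) K) id x, (mem_leviP_iff _).2 (by
    rw [leviProjection_leviEmbeddingP_apply])⟩

/-- `leviOfBlocks` is continuous. [folklore] -/
theorem continuous_leviOfBlocks : Continuous (leviOfBlocks (n := n) (K := K)) :=
  (continuous_leviEmbeddingP (AdeleRing (𝓞 K) K) (id : Fin n → Fin n)).subtype_mk _

/-- A Levi element is `leviOfBlocks` of its Levi projection. [folklore] -/
theorem leviOfBlocks_leviProjB (m : ↥(leviBorelAdelic n K)) :
    leviOfBlocks (leviProjB (m : ↥(borelAdelic n K))) = m :=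
  Subtype.ext ((mem_leviP_iff _).1 m.2)

/-- The set of all entries of the matrices of a set of Borel elements. [folklore] -/
def entrySet (S : Set ↥(borelAdelic n K)) : Set (AdeleRing (𝓞 K) K) :=
  ⋃ i : Fin n, ⋃ j : Fin n, (fun p => borelMatrix p i j) '' S

/-- Entries of elements of `S` lie in `entrySet S`. [folklore] -/
theorem mem_entrySet {S : Set ↥(borelAdelic n K)} {p : ↥(borelAdelic n K)} (hp : p ∈ S) (i j : Fin n) :
    borelMatrix p i j ∈ entrySet S :=
  Set.mem_iUnion.2 ⟨i, Set.mem_iUnion.2 ⟨j, ⟨p, hp, rfl⟩⟩⟩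

/-- The entry set of a compact set is compact. [folklore] -/
theorem isCompact_entrySet {S : Set ↥(borelAdelic n K)} (hS : IsCompact S) : IsCompact (entrySet S) :=
  isCompact_iUnion fun i => isCompact_iUnion fun j =>
    hS.image (continuous_borelMatrix.matrix_elem i j)

end Fibre


/-! ### The Haar volume of `a⁻¹ C_Ω a · D · K` decays like `∏_{i<j} (b_j/b_i)^{[K:ℚ]}` -/

section VolumeDecay

variable (n : ℕ) (K : Type) [Field K] [NumberField K]

attribute [local instance] adelicBorel borelSpace_adelic locallyCompactSpace_adelic
  secondCountableTopology_gl_adelic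

variable [MeasurableSpace (AdeleRing (𝓞 K) K)] [BorelSpace (AdeleRing (𝓞 K) K)]

omit [MeasurableSpace (AdeleRing (𝓞 K) K)] [BorelSpace (AdeleRing (𝓞 K) K)] in
/-- The adelic Borel subgroup is closed in `GL_n(𝔸_K)`. [folklore] -/
theorem isClosed_borelAdelic : IsClosed (borelAdelic n K : Set (AdelicGroupData.gl n K).Adelic) :=
  isClosed_parabolicAdelic n K (id : Fin n → Fin n)

variable {n K} in
omit [MeasurableSpace (AdeleRing (𝓞 K) K)] [BorelSpace (AdeleRing (𝓞 K) K)] in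
/-- The real scaling of the archimedean component: `(r, 1) · (y_∞, y_f) = (r y_∞, y_f)`. [folklore] -/
theorem realAdele_mul_mk (r : ℝ) (y₁ : InfiniteAdeleRing K) (y₂ : FiniteAdeleRing (𝓞 K) K) :
    realAdele K r * (show AdeleRing (𝓞 K) K from (y₁, y₂)) =
      (show AdeleRing (𝓞 K) K from (realToInfiniteAdele K r * y₁, y₂)) :=
  Prod.ext rfl (one_mul y₂)


variable {n K} in
/-- **Volume of a scaled box in `𝔸_K`**: for an additive Haar measure `μ` of `𝔸_K`, compact
(indeed any) `C_∞ ⊆ K_∞`, `C_f ⊆ 𝔸_K^∞` and `t > 0`,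
`μ ((t, 1) · (C_∞ × C_f)) = t^{[K:ℚ]} μ (C_∞ × C_f)` (`AdeleRing.addHaar_posRealIdele_smul`).
[folklore] -/
theorem addHaar_image_realAdele_mul (μA : Measure (AdeleRing (𝓞 K) K)) [μA.IsAddHaarMeasure] [μA.Regular]
    [LocallyCompactSpace (AdeleRing (𝓞 K) K)] (t : ℝ≥0ˣ) (s : Set (AdeleRing (𝓞 K) K)) :
    μA ((fun y => realAdele K ((t : ℝ≥0) : ℝ) * y) '' s) = ((t : ℝ≥0) : ℝ≥0∞) ^ Module.finrank ℚ K * μA s := by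
  have : (fun y => realAdele K ((t : ℝ≥0) : ℝ) * y) '' s = posRealIdele K t • s := by
    ext x
    simp only [Set.mem_image, Set.mem_smul_set, Units.smul_def, smul_eq_mul, coe_posRealIdele]
  rw [this, AdeleRing.addHaar_posRealIdele_smul]

/-- **Volume decay of translated Siegel boxes.** Let `ν` be a Haar measure on `GL_n(𝔸_K)`,
`C_Ω ⊆ B(𝔸_K)` compact and `D ⊆ B(𝔸_K)` a compact set of diagonal matrices. There is `C < ∞`
such that for every positive real diagonal `a = diag(b)`,
`ν (a⁻¹ C_Ω a · D · K) ≤ C · ∏_{i<j} (b_j / b_i)^{[K:ℚ]}`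
(`K = K_∞ GL_n(𝒪̂_K)` the standard maximal compact subgroup). Proof: Haar measure in Iwasawa
coordinates `G = B K` (`HaarHK.eq_smul_map_prod`) and Levi coordinates `B = M N`
(`IsTopSemidirect.isHaarMeasure_map` with the coordinate Haar measure of `N`); the fibre of the
set over the Levi part lies in a coordinate box whose `(i, j)` side is the real dilate by
`b_j / b_i` of a fixed compact subset of `𝔸_K` (the archimedean parts of the off-diagonal entries of
`K ∩ B(𝔸_K)` vanish), of Haar measure `(b_j/b_i)^{[K:ℚ]}` times a constant. This is the
computation behind the finiteness of the volume of Siegel sets (Borel, *Introduction aux groupes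
arithmétiques* (1969), Lemme 12.5; Godement, Sém. Bourbaki 257, §8; Platonov–Rapinchuk (1994),
§4.? for `SL_n(ℝ)`). [folklore] -/
theorem exists_measure_coneConj_mul_le (ν : Measure (AdelicGroupData.gl n K).Adelic) [ν.IsHaarMeasure]
    {CΩ D₁ : Set (AdelicGroupData.gl n K).Adelic} (hCΩ : IsCompact CΩ)
    (hCΩP : CΩ ⊆ (borelAdelic n K : Set (AdelicGroupData.gl n K).Adelic)) (hD₁ : IsCompact D₁)
    (hD₁P : D₁ ⊆ (borelAdelic n K : Set (AdelicGroupData.gl n K).Adelic))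
    (hD₁d : ∀ g ∈ D₁, ∀ i j : Fin n, i ≠ j → adelicMatrix g i j = 0) :
    ∃ C : ℝ≥0∞, C ≠ ⊤ ∧ ∀ b : Fin n → ℝ≥0ˣ,
      ν ((fun g : (AdelicGroupData.gl n K).Adelic => (coneAdelic b)⁻¹ * g * coneAdelic b) '' CΩ * D₁ *
          (maximalCompactAdelic n K : Set (AdelicGroupData.gl n K).Adelic)) ≤
        C * ∏ p : UpperIndex n, (((b p.1.2 / b p.1.1 : ℝ≥0ˣ) : ℝ≥0) : ℝ≥0∞) ^ Module.finrank ℚ K := by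
  classical
  -- instances
  haveI : T2Space (AdeleRing (𝓞 K) K) := t2Space_adeleRing K
  haveI : T2Space (AdelicGroupData.gl n K).Adelic := inferInstanceAs (T2Space (GL (Fin n) (AdeleRing (𝓞 K) K)))
  haveI := secondCountableTopology_adeleRing K
  haveI := locallyCompactSpace_adeleRing' K
  have hPc : IsClosed (borelAdelic n K : Set (AdelicGroupData.gl n K).Adelic) := isClosed_borelAdelic n K
  have hKcc : IsCompact (maximalCompactAdelic n K : Set (AdelicGroupData.gl n K).Adelic) :=
    isCompact_maximalCompactAdelic n K
  haveI : LocallyCompactSpace ↥(borelAdelic n K) := hPc.locallyCompactSpace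
  haveI : SecondCountableTopology ↥(borelAdelic n K) := TopologicalSpace.Subtype.secondCountableTopology _
  set e : ↥(leviBorelAdelic n K) × ↥(unipotentBorelAdelic n K) ≃ₜ ↥(borelAdelic n K) :=
    leviUnipotentHomeomorph (AdeleRing (𝓞 K) K) (id : Fin n → Fin n) with hedef
  have hsd : IsTopSemidirect (leviBorelAdelic n K) (unipotentBorelAdelic n K) e :=
    isTopSemidirect_parabolicAdelic n K (id : Fin n → Fin n)
  haveI : LocallyCompactSpace ↥(leviBorelAdelic n K) := hsd.isClosed_left.locallyCompactSpace
  haveI : CompactSpace ↥(maximalCompactAdelic n K) := isCompact_iff_compactSpace.1 hKcc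
  -- the measures
  set μA : Measure (AdeleRing (𝓞 K) K) := Measure.addHaar with hμA
  set μM : Measure ↥(leviBorelAdelic n K) := Measure.haar with hμM
  set lamU : Measure ↥(unipotentBorelAdelic n K) := unipotentCoordHaar n K μA with hlamU
  set μP : Measure ↥(borelAdelic n K) := (μM.prod lamU).map e with hμP
  haveI : μP.IsHaarMeasure := hsd.isHaarMeasure_map μM lamU
  set μK : Measure ↥(maximalCompactAdelic n K) := Measure.haar with hμK
  have hIw : ∀ g : (AdelicGroupData.gl n K).Adelic, ∃ p ∈ borelAdelic n K, ∃ k ∈ maximalCompactAdelic n K, g = p * k :=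
    exists_parabolicAdelic_mul_maximalCompactAdelic n K (iwasawaDecomposition_gl_adelic_holds n K) monotone_id
  have hν := HaarHK.eq_smul_map_prod hPc hKcc hIw ν μP μK
  set c : ℝ≥0 := HaarHK.decompConst hPc hKcc hIw ν μP μK with hcdef
  haveI : SecondCountableTopology ↥(leviBorelAdelic n K) := TopologicalSpace.Subtype.secondCountableTopology _
  haveI : SecondCountableTopology ↥(unipotentBorelAdelic n K) :=
    TopologicalSpace.Subtype.secondCountableTopology _
  haveI : SecondCountableTopology ↥(maximalCompactAdelic n K) := TopologicalSpace.Subtype.secondCountableTopology _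
  haveI : LocallyCompactSpace ↥(unipotentBorelAdelic n K) := hsd.isClosed_right.locallyCompactSpace
  haveI : IsFiniteMeasure μK := CompactSpace.isFiniteMeasure
  -- the compact pieces inside the Borel
  have hcoe : Topology.IsClosedEmbedding (Subtype.val : ↥(borelAdelic n K) → (AdelicGroupData.gl n K).Adelic) :=
    hPc.isClosedEmbedding_subtypeVal
  set CΩ' : Set ↥(borelAdelic n K) := Subtype.val ⁻¹' CΩ
  set D₁' : Set ↥(borelAdelic n K) := Subtype.val ⁻¹' D₁
  set KP : Set ↥(borelAdelic n K) :=
    Subtype.val ⁻¹' (maximalCompactAdelic n K : Set (AdelicGroupData.gl n K).Adelic)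
  have hCΩ'c : IsCompact CΩ' := hcoe.isCompact_preimage hCΩ
  have hD₁'c : IsCompact D₁' := hcoe.isCompact_preimage hD₁
  have hKPc : IsCompact KP := hcoe.isCompact_preimage hKcc
  -- the Levi parts and the compact set of entries
  have hℓ : Continuous (leviProjB (n := n) (K := K)) := continuous_leviProjection _ _
  set T : Set (Π a : Fin n, GL {i : Fin n // id i = a} (AdeleRing (𝓞 K) K)) :=
    leviProjB '' CΩ' * leviProjB '' D₁' * leviProjB '' KP
  have hTc : IsCompact T := ((hCΩ'c.image hℓ).mul (hD₁'c.image hℓ)).mul (hKPc.image hℓ)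
  set M₁ : Set ↥(leviBorelAdelic n K) := leviOfBlocks '' T
  have hM₁c : IsCompact M₁ := hTc.image continuous_leviOfBlocks
  set Minv : Set ↥(borelAdelic n K) :=
    (fun m : ↥(leviBorelAdelic n K) => ((m⁻¹ : ↥(leviBorelAdelic n K)) : ↥(borelAdelic n K))) '' M₁
  have hMinvc : IsCompact Minv := hM₁c.image (continuous_subtype_val.comp continuous_inv)
  set S₀ : Set ↥(borelAdelic n K) := CΩ' ∪ D₁' ∪ KP ∪ Minv
  have hS₀c : IsCompact S₀ := ((hCΩ'c.union hD₁'c).union hKPc).union hMinvc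
  set Q : Set (AdeleRing (𝓞 K) K) := entrySet S₀
  have hQc : IsCompact Q := isCompact_entrySet hS₀c
  have hQ4c : IsCompact (Q * Q * (Q * Q)) := (hQc.mul hQc).mul (hQc.mul hQc)
  set Cinf : Set (InfiniteAdeleRing K) := Prod.fst '' (Q * Q * (Q * Q))
  have hCinfc : IsCompact Cinf := hQ4c.image continuous_fst
  set SumSet : Set (AdeleRing (𝓞 K) K) :=
    (fun g : Fin n → AdeleRing (𝓞 K) K => ∑ l, g l) '' (Set.pi Set.univ fun _ => Q * (Q * Q))
  have hSumc : IsCompact SumSet :=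
    (isCompact_univ_pi fun _ => hQc.mul (hQc.mul hQc)).image
      (continuous_finsetSum _ fun l _ => continuous_apply l)
  set Cf : Set (FiniteAdeleRing (𝓞 K) K) := Prod.snd '' (Q * SumSet)
  have hCfc : IsCompact Cf := (hQc.mul hSumc).image continuous_snd
  set Box0 : Set (AdeleRing (𝓞 K) K) := (Cinf ×ˢ Cf : Set (InfiniteAdeleRing K × FiniteAdeleRing (𝓞 K) K))
  have hBox0c : IsCompact Box0 := hCinfc.prod hCfc
  -- the constant
  refine ⟨(c : ℝ≥0∞) * μK Set.univ * (μM M₁ * μA Box0 ^ Fintype.card (UpperIndex n)), ?_, fun b => ?_⟩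
  · refine ENNReal.mul_ne_top (ENNReal.mul_ne_top ENNReal.coe_ne_top (measure_lt_top _ _).ne)
      (ENNReal.mul_ne_top hM₁c.measure_lt_top.ne (ENNReal.pow_ne_top hBox0c.measure_lt_top.ne))
  -- the set and its measurability
  set E : Set (AdelicGroupData.gl n K).Adelic :=
    (fun g : (AdelicGroupData.gl n K).Adelic => (coneAdelic b)⁻¹ * g * coneAdelic b) '' CΩ * D₁ *
      (maximalCompactAdelic n K : Set (AdelicGroupData.gl n K).Adelic)
  have hEc : IsCompact E :=
    ((hCΩ.image ((continuous_const.mul continuous_id).mul continuous_const)).mul hD₁).mul hKcc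
  have hEm : MeasurableSet E := hEc.isClosed.measurableSet
  -- Step 1: Iwasawa coordinates
  have h1 : ν E = c * (μP.prod μK)
      (HaarHK.hkMap (borelAdelic n K) (maximalCompactAdelic n K) ⁻¹' E) := by
    have h := congrArg (fun m : Measure (AdelicGroupData.gl n K).Adelic => m E) hν
    simp only [Measure.smul_apply, smul_eq_mul] at h
    rw [Measure.map_apply HaarHK.continuous_hkMap.measurable hEm] at h
    exact h
  -- Step 2: the `K`-coordinate is free
  set A : Set ↥(borelAdelic n K) := Subtype.val ⁻¹' E
  have hAm : MeasurableSet A := hEm.preimage continuous_subtype_val.measurable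
  have h2 : HaarHK.hkMap (borelAdelic n K) (maximalCompactAdelic n K) ⁻¹' E ⊆ A ×ˢ Set.univ := by
    rintro ⟨p, k⟩ hpk
    refine Set.mk_mem_prod ?_ (Set.mem_univ _)
    obtain ⟨x, hx, k', hk', hxk⟩ := hpk
    change x * k' = (p : (AdelicGroupData.gl n K).Adelic) * ((k : (AdelicGroupData.gl n K).Adelic))⁻¹ at hxk
    refine ⟨x, hx, k' * k, mul_mem hk' k.2, ?_⟩
    change x * (k' * (k : (AdelicGroupData.gl n K).Adelic)) = (p : (AdelicGroupData.gl n K).Adelic)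
    rw [← mul_assoc, hxk, inv_mul_cancel_right]
  -- Step 3: the fibre over the Levi lies in a coordinate box
  set r : UpperIndex n → ℝ≥0ˣ := fun q => b q.1.2 / b q.1.1
  set Dbox : UpperIndex n → Set (AdeleRing (𝓞 K) K) :=
    fun q => (fun y => realAdele K ((r q : ℝ≥0) : ℝ) * y) '' Box0
  have h3 : e ⁻¹' A ⊆ M₁ ×ˢ {u | ∀ q, unipCoords u q ∈ Dbox q} := by
    rintro ⟨m, u⟩ hmu
    have hmu' : (((m : ↥(borelAdelic n K)) * (u : ↥(borelAdelic n K)) : ↥(borelAdelic n K)) :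
        (AdelicGroupData.gl n K).Adelic) ∈ E := hmu
    obtain ⟨_, ⟨_, ⟨cG, hcG, rfl⟩, dG, hdG, rfl⟩, kG, hkG, hEq⟩ := hmu'
    set c' : ↥(borelAdelic n K) := ⟨cG, hCΩP hcG⟩
    set d' : ↥(borelAdelic n K) := ⟨dG, hD₁P hdG⟩
    set Y : ↥(borelAdelic n K) := (coneBorel b)⁻¹ * c' * coneBorel b * d'
    set k' : ↥(borelAdelic n K) := Y⁻¹ * ((m : ↥(borelAdelic n K)) * (u : ↥(borelAdelic n K)))
    have heqP : (m : ↥(borelAdelic n K)) * (u : ↥(borelAdelic n K)) = (coneBorel b)⁻¹ * c' * coneBorel b * d' * k' :=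
      (mul_inv_cancel_left Y _).symm
    have hk'G : (k' : (AdelicGroupData.gl n K).Adelic) = kG := by
      change (Y : (AdelicGroupData.gl n K).Adelic)⁻¹ *
        (((m : ↥(borelAdelic n K)) * (u : ↥(borelAdelic n K)) : ↥(borelAdelic n K)) :
          (AdelicGroupData.gl n K).Adelic) = kG
      rw [← hEq]
      exact inv_mul_cancel_left _ _
    have hk'K : ((k' : (AdelicGroupData.gl n K).Adelic) : GL (Fin n) (AdeleRing (𝓞 K) K)) ∈
        standardMaximalCompactGL n K := by rw [hk'G]; exact hkG
    have hc'S : c' ∈ S₀ := Or.inl (Or.inl (Or.inl hcG))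
    have hd'S : d' ∈ S₀ := Or.inl (Or.inl (Or.inr hdG))
    have hk'S : k' ∈ S₀ := Or.inl (Or.inr (show (k' : (AdelicGroupData.gl n K).Adelic) ∈ _ by rw [hk'G]; exact hkG))
    have hd'M : d' ∈ leviBorelAdelic n K := mem_leviBorelAdelic_of_apply_ne (hD₁d dG hdG)
    -- the Levi part
    have hmT : leviProjB (m : ↥(borelAdelic n K)) ∈ T :=
      ⟨leviProjB c' * leviProjB d', ⟨leviProjB c', ⟨c', hcG, rfl⟩, leviProjB d', ⟨d', hdG, rfl⟩, rfl⟩,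
        leviProjB k', ⟨k', show (k' : (AdelicGroupData.gl n K).Adelic) ∈ _ by rw [hk'G]; exact hkG, rfl⟩,
        (leviProjB_of_eq heqP).symm⟩
    have hmM : m ∈ M₁ := ⟨_, hmT, leviOfBlocks_leviProjB m⟩
    have hmS : ((m⁻¹ : ↥(leviBorelAdelic n K)) : ↥(borelAdelic n K)) ∈ S₀ := Or.inr ⟨m, hmM, rfl⟩
    refine Set.mk_mem_prod hmM fun q => ?_
    obtain ⟨⟨i, j⟩, hij⟩ := q
    -- the entry `u i j`
    set x : AdeleRing (𝓞 K) K := unipMatrix u i j with hx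
    set y : AdeleRing (𝓞 K) K := borelMatrix ((m⁻¹ : ↥(leviBorelAdelic n K)) : ↥(borelAdelic n K)) i i *
      borelMatrix c' i j * (borelMatrix d' j j * borelMatrix k' j j) with hy
    have hyQ : y ∈ Q * Q * (Q * Q) :=
      Set.mul_mem_mul (Set.mul_mem_mul (mem_entrySet hmS i i) (mem_entrySet hc'S i j))
        (Set.mul_mem_mul (mem_entrySet hd'S j j) (mem_entrySet hk'S j j))
    have hx1 : x.1 = realToInfiniteAdele K (((b j : ℝ≥0) : ℝ) / ((b i : ℝ≥0) : ℝ)) * y.1 :=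
      unipMatrix_fst_of_eq hd'M hk'K heqP i j
    have hx2 : x.2 ∈ Cf := by
      refine ⟨_, Set.mul_mem_mul (mem_entrySet hmS i i) ⟨fun l => borelMatrix c' i l *
        (borelMatrix d' l l * borelMatrix k' l j), Set.mem_univ_pi.2 fun l =>
          Set.mul_mem_mul (mem_entrySet hc'S i l) (Set.mul_mem_mul (mem_entrySet hd'S l l)
            (mem_entrySet hk'S l j)), rfl⟩, ?_⟩
      exact (unipMatrix_snd_of_eq hd'M heqP i j).symm
    change x ∈ Dbox ⟨(i, j), hij⟩
    refine ⟨(show AdeleRing (𝓞 K) K from (y.1, x.2)), Set.mk_mem_prod ⟨y, hyQ, rfl⟩ hx2, ?_⟩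
    have hr : (((r ⟨(i, j), hij⟩ : ℝ≥0ˣ) : ℝ≥0) : ℝ) = ((b j : ℝ≥0) : ℝ) / ((b i : ℝ≥0) : ℝ) := by
      simp only [r, Units.val_div_eq_div_val, NNReal.coe_div]
    change realAdele K _ * _ = x
    rw [hr, realAdele_mul_mk]
    exact Prod.ext hx1.symm rfl
  -- Step 4: the measures
  have h4 : lamU {u | ∀ q, unipCoords u q ∈ Dbox q} = ∏ q, μA (Dbox q) := unipotentCoordHaar_box μA Dbox
  have h5 : ∀ q, μA (Dbox q) = ((r q : ℝ≥0) : ℝ≥0∞) ^ Module.finrank ℚ K * μA Box0 := fun q =>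
    addHaar_image_realAdele_mul μA (r q) Box0
  calc ν E = c * (μP.prod μK) (HaarHK.hkMap (borelAdelic n K) (maximalCompactAdelic n K) ⁻¹' E) := h1
    _ ≤ c * (μP.prod μK) (A ×ˢ Set.univ) := by gcongr
    _ = c * (μP A * μK Set.univ) := by rw [Measure.prod_prod]
    _ = c * ((μM.prod lamU) (e ⁻¹' A) * μK Set.univ) := by
        rw [hμP, Measure.map_apply e.continuous.measurable hAm]
    _ ≤ c * ((μM.prod lamU) (M₁ ×ˢ {u | ∀ q, unipCoords u q ∈ Dbox q}) * μK Set.univ) := by gcongr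
    _ = c * (μM M₁ * lamU {u | ∀ q, unipCoords u q ∈ Dbox q} * μK Set.univ) := by rw [Measure.prod_prod]
    _ = (c : ℝ≥0∞) * μK Set.univ * (μM M₁ * μA Box0 ^ Fintype.card (UpperIndex n)) *
          ∏ q : UpperIndex n, (((b q.1.2 / b q.1.1 : ℝ≥0ˣ) : ℝ≥0) : ℝ≥0∞) ^ Module.finrank ℚ K := by
        rw [h4]
        simp_rw [h5]
        rw [Finset.prod_mul_distrib, Finset.prod_const, Finset.card_univ]
        ring

end VolumeDecay

end Literature.NumberTheory.Automorphic
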